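import Summits.AtomisticToContinuum.HydrodynamicLimit.Theses.LambertianContactSwap
import Summits.AtomisticToContinuum.HydrodynamicLimit.Theorems.LambertianContactSwapSwapGapEntropyTransfer
import Summits.AtomisticToContinuum.HydrodynamicLimit.Theorems.JParityClosureParityInBandSmoothTest
import Summits.AtomisticToContinuum.HydrodynamicLimit.Theorems.JParityClosureParityInBandEnergyTight
import Summits.AtomisticToContinuum.HydrodynamicLimit.Theorems.LambertianContactSwapSwapGapEntropyBudgetStatics
import Literature.MathematicalPhysics.KineticTheory.LambertianHardSphereFlow
import Literature.MathematicalPhysics.KineticTheory.HardSphereEulerProofs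
import HarnessLib

/-!
# `SwapGap` (stmt-AtomisticToContinuum-11850), line `Sketch`, interface stub T1: SMOOTH TEST FUNCTIONS SUFFICE

Helper file (`--supports stmt-AtomisticToContinuum-11850`) of line `Sketch` (card `entropy-relative-to-lambertian-law`) for
the crux `Summit.AtomisticToContinuum.HydrodynamicLimit.Theses.LambertianContactSwap.SwapGap`, registered stub
`stub_swapGap_of_smoothTest` (T1) of the lead's skeleton v8/v9: `SwapGap` follows from its restriction to test functions
`χ : 𝕋³ → ℝ` with smooth periodic lift (`Torus.IsSmooth χ`).

Proof. Fix the profiles, `σ < σ₀ := min (1/2) σ₁` (`σ₁` from the hypothesis), Euler data, flows `Φ`, the `t = 0`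
hypothesis, `t`, a continuous `χ`, a `1`-Lipschitz `F` bounded by `1`, and `η > 0`.
* `exists_lintegral_sum_norm_sq_localGibbsLaw_le` (`σ ≤ 1/2`): `E_{P_N} ∑ᵢ ‖vᵢ‖² ≤ C (N + 1)`, so the kinetic energy per
  particle `e_1 := empiricalEnergyField · 1` has `∫ e_1 dP_N ≤ C/2` for all `N` and all flows
  (`SwapGapSmoothTest.integrable_energy_of_lintegral_le`);
* `e_1` is conserved along `Φ_t` on the good set, which is `P_N`-conull (`empiricalEnergyField_one_flow`,
  `localGibbsLaw_compl_good`), and does not increase along the Lambertian flow `Λ_t` (`configEnergy_lambertFlow_le`);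
* pick a smooth `ψ` with `‖ψ − χ‖_∞ ≤ δ'`, `δ' (2 + C) = η/4` (`exists_isSmooth_near`); since `F` is `1`-Lipschitz for the
  sup metric of `ℝ × V3 × ℝ`, `|F(fld_χ w) − F(fld_ψ w)| ≤ δ' (1 + e_1 w)` (`empiricalFields_sub_le`,
  `SwapGapSmoothTest.abs_sub_le_of_lipschitz`), hence each of the two integrals of the crux moves by at most
  `δ' (1 + C/2)` when `χ` is replaced by `ψ` (`SwapGapSmoothTest.abs_integral_sub_le_of_lipschitz`), uniformly in `N`;
* the hypothesis at `ψ` makes the `ψ`-difference eventually `< η/2`, so the `χ`-difference is eventually `< η`.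

prover-line-stmt-AtomisticToContinuum-11850-c5-0 (wave 6 worker, stub T1), cycle 6.
-/

noncomputable section

open MeasureTheory Filter Set Topology
open scoped ENNReal

namespace Summit.AtomisticToContinuum.HydrodynamicLimit.Theorems

open Literature.Analysis.FluidPDE Literature.MathematicalPhysics.KineticTheory
open Literature.Analysis.FunctionSpaces
open Summit.AtomisticToContinuum.HydrodynamicLimit.Theses.LambertianContactSwap

namespace SwapGapSmoothTest

/-! ### Plumbing: the kinetic energy per particle -/

/-- The kinetic energy per particle `e_1(z) = (N+1)⁻¹ · ½ ∑ᵢ ‖vᵢ‖²` is nonnegative. [folklore] -/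
theorem empiricalEnergyField_one_nonneg {N : ℕ} (z : Config (N + 1) (Fin 3) T3) :
    0 ≤ empiricalEnergyField z (fun _ => (1 : ℝ)) := by
  rw [empiricalEnergyField_one_eq]
  refine mul_nonneg (by positivity) ?_
  unfold configEnergy
  positivity

/-- **Integrability and mean of the kinetic energy per particle** from a bound on `∫⁻ ∑ᵢ ‖vᵢ‖²`: if
`∫⁻ ∑ᵢ ‖vᵢ‖² dμ ≤ C (N + 1)` then `e_1` is `μ`-integrable with `∫ e_1 dμ ≤ C/2`. [folklore] -/
theorem integrable_energy_of_lintegral_le {N : ℕ} (μ : Measure (Config (N + 1) (Fin 3) T3))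
    {C : ℝ} (hC0 : 0 ≤ C)
    (hμ : ∫⁻ z, ENNReal.ofReal (∑ i, ‖(z i).2‖ ^ 2) ∂μ ≤ ENNReal.ofReal (C * ((N : ℝ) + 1))) :
    Integrable (fun z => empiricalEnergyField z (fun _ => (1 : ℝ))) μ ∧
      ∫ z, empiricalEnergyField z (fun _ => (1 : ℝ)) ∂μ ≤ C / 2 := by
  set K : Config (N + 1) (Fin 3) T3 → ℝ := fun z => ∑ i, ‖(z i).2‖ ^ 2 with hK
  have hKm : Measurable K :=
    Finset.measurable_sum _ fun i _ => ((measurable_pi_apply i).snd.norm).pow_const 2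
  have hK0 : ∀ z, 0 ≤ K z := fun z => Finset.sum_nonneg fun i _ => by positivity
  have hKint : Integrable K μ :=
    ⟨hKm.aestronglyMeasurable,
      (hasFiniteIntegral_iff_ofReal (ae_of_all _ hK0)).2 (hμ.trans_lt ENNReal.ofReal_lt_top)⟩
  have hKle : ∫ z, K z ∂μ ≤ C * ((N : ℝ) + 1) := by
    rw [← ENNReal.ofReal_le_ofReal_iff (by positivity),
      ofReal_integral_eq_lintegral_ofReal hKint (ae_of_all _ hK0)]
    exact hμ
  have he : (fun z : Config (N + 1) (Fin 3) T3 => empiricalEnergyField z (fun _ => (1 : ℝ))) =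
      fun z => (((N + 1 : ℕ) : ℝ))⁻¹ * (2⁻¹ * K z) := by
    funext z
    rw [empiricalEnergyField_one_eq]
    rfl
  rw [he]
  refine ⟨(hKint.const_mul _).const_mul _, ?_⟩
  rw [integral_const_mul, integral_const_mul]
  have hN : (0 : ℝ) < ((N + 1 : ℕ) : ℝ) := by positivity
  calc (((N + 1 : ℕ) : ℝ))⁻¹ * (2⁻¹ * ∫ z, K z ∂μ)
      ≤ (((N + 1 : ℕ) : ℝ))⁻¹ * (2⁻¹ * (C * ((N : ℝ) + 1))) := by gcongr
    _ = C / 2 := by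
      push_cast
      field_simp

/-! ### Perturbing the test function inside a bounded Lipschitz statistic -/

/-- **The field triple is `δ'(1 + e_1)`-close when the test function moves by `δ'`**, seen through a
`1`-Lipschitz `F` for the sup metric of `ℝ × V3 × ℝ`: `|F(fld_χ z) − F(fld_ψ z)| ≤ δ' (1 + e_1(z))`
(`empiricalFields_sub_le`: the components move by `δ'`, `δ'(1/2 + e_1)`, `δ' e_1`). [folklore] -/
theorem abs_sub_le_of_lipschitz {F : ℝ × V3 × ℝ → ℝ} (hF : LipschitzWith 1 F) {N : ℕ}
    (z : Config (N + 1) (Fin 3) T3) {χ ψ : T3 → ℝ} {δ' : ℝ} (hδ' : 0 ≤ δ')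
    (hclose : ∀ x, |ψ x - χ x| ≤ δ') :
    |F (empiricalDensityField z χ, empiricalMomentumField z χ, empiricalEnergyField z χ) -
        F (empiricalDensityField z ψ, empiricalMomentumField z ψ, empiricalEnergyField z ψ)| ≤
      δ' * (1 + empiricalEnergyField z (fun _ => (1 : ℝ))) := by
  obtain ⟨h1, h2, h3⟩ := empiricalFields_sub_le z hclose
  have he := empiricalEnergyField_one_nonneg z
  have hL := hF.dist_le_mul
    (empiricalDensityField z χ, empiricalMomentumField z χ, empiricalEnergyField z χ)
    (empiricalDensityField z ψ, empiricalMomentumField z ψ, empiricalEnergyField z ψ)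
  simp only [NNReal.coe_one, one_mul, Prod.dist_eq, Real.dist_eq] at hL
  rw [dist_eq_norm] at hL
  refine hL.trans (max_le ?_ (max_le ?_ ?_))
  · rw [abs_sub_comm]
    exact h1.trans (le_mul_of_one_le_right hδ' (by linarith))
  · rw [norm_sub_rev]
    exact h2.trans (mul_le_mul_of_nonneg_left (by linarith) hδ')
  · rw [abs_sub_comm]
    exact h3.trans (mul_le_mul_of_nonneg_left (by linarith) hδ')

/-- **Both integrals of the crux move by at most `δ'(1 + B)` when `χ` is replaced by a `δ'`-close `ψ`.**
On a probability space, for a measurable configuration-valued `w` whose kinetic energy per particle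
`e_1 ∘ w` is integrable with mean `≤ B`, a `1`-Lipschitz `F` bounded by `1` and continuous `χ, ψ` with
`|ψ − χ| ≤ δ'`: `|∫ F(fld_χ ∘ w) − ∫ F(fld_ψ ∘ w)| ≤ δ' (1 + B)`. [folklore] -/
theorem abs_integral_sub_le_of_lipschitz {Ω : Type*} [MeasurableSpace Ω] (μ : Measure Ω)
    [IsProbabilityMeasure μ] {F : ℝ × V3 × ℝ → ℝ} (hF : LipschitzWith 1 F) (hF1 : ∀ y, |F y| ≤ 1)
    {N : ℕ} {w : Ω → Config (N + 1) (Fin 3) T3} (hw : Measurable w) {χ ψ : T3 → ℝ}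
    (hχ : Continuous χ) (hψ : Continuous ψ) {δ' : ℝ} (hδ' : 0 ≤ δ')
    (hclose : ∀ x, |ψ x - χ x| ≤ δ')
    (he : Integrable (fun ω => empiricalEnergyField (w ω) (fun _ => (1 : ℝ))) μ) {B : ℝ}
    (hB : ∫ ω, empiricalEnergyField (w ω) (fun _ => (1 : ℝ)) ∂μ ≤ B) :
    |(∫ ω, F (empiricalDensityField (w ω) χ, empiricalMomentumField (w ω) χ,
        empiricalEnergyField (w ω) χ) ∂μ) -
      ∫ ω, F (empiricalDensityField (w ω) ψ, empiricalMomentumField (w ω) ψ,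
        empiricalEnergyField (w ω) ψ) ∂μ| ≤ δ' * (1 + B) := by
  have hint : ∀ {χ' : T3 → ℝ}, Continuous χ' → Integrable (fun ω =>
      F (empiricalDensityField (w ω) χ', empiricalMomentumField (w ω) χ',
        empiricalEnergyField (w ω) χ')) μ := fun hχ' =>
    Integrable.of_bound
      (hF.continuous.measurable.comp ((measurable_fieldTriple hχ').comp hw)).aestronglyMeasurable 1
      (ae_of_all _ fun ω => by
        rw [Real.norm_eq_abs]
        exact hF1 _)
  have hgi : Integrable (fun ω => δ' * (1 + empiricalEnergyField (w ω) (fun _ => (1 : ℝ)))) μ :=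
    (integrable_const_add_iff.2 he).const_mul δ'
  rw [← integral_sub (hint hχ) (hint hψ)]
  refine abs_integral_le_integral_abs.trans ?_
  refine (integral_mono_of_nonneg (ae_of_all _ fun ω => abs_nonneg _) hgi
    (ae_of_all _ fun ω => abs_sub_le_of_lipschitz hF (w ω) hδ' hclose)).trans ?_
  rw [integral_const_mul, integral_add (integrable_const _) he, integral_const, probReal_univ,
    one_smul]
  gcongr

/-- Elementary bookkeeping: `|a − a'| ≤ B`, `|b − b'| ≤ B`, `|a' − b'| < η/2` and `2B ≤ η/2` give
`|a − b| < η`. [folklore] -/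
theorem abs_sub_lt_of_near {a a' b b' B η : ℝ} (h1 : |a - a'| ≤ B) (h2 : |b - b'| ≤ B)
    (h3 : |a' - b'| < η / 2) (hB : 2 * B ≤ η / 2) : |a - b| < η := by
  have h4 := abs_sub_le a a' b
  have h5 := abs_sub_le a' b' b
  rw [abs_sub_comm b' b] at h5
  linarith

/-! ### The reduction to smooth test functions, over the named Lambertian API -/

/-- **Smooth test functions suffice, named form.** For continuous positive profiles, `0 < σ < 1/2`,
flows `Φ`, a time `t`, a `1`-Lipschitz `F` bounded by `1`: if the difference of the crux's two integrals
tends to `0` for every smooth test function `ψ`, then it tends to `0` for every continuous `χ`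
(uniform kinetic-energy bound under the local Gibbs laws, conservation along `Φ`, non-increase along
`Λ`, density of smooth functions, `F` Lipschitz for the sup metric). [folklore] -/
theorem tendsto_of_smoothTest {a₀ θ₀ : T3 → ℝ} {u₀ : T3 → V3} (ha : Continuous a₀)
    (hθ : Continuous θ₀) (hu : Continuous u₀) (ha0 : ∀ x, 0 < a₀ x) (hθ0 : ∀ x, 0 < θ₀ x)
    {σ : ℝ} (hσ : 0 < σ) (hσhalf : σ < 2⁻¹)
    (Φ : (N : ℕ) → HardSphereFlow (Torus.geometry (Fin 3)) (hsDiameter σ N) (N + 1)) (t : ℝ)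
    {F : ℝ × V3 × ℝ → ℝ} (hF : LipschitzWith 1 F) (hF1 : ∀ y, |F y| ≤ 1)
    (hsmooth : ∀ ψ : T3 → ℝ, Torus.IsSmooth ψ →
      Tendsto (fun N : ℕ =>
        (∫ z, F (empiricalDensityField ((Φ N).flow t z) ψ,
            empiricalMomentumField ((Φ N).flow t z) ψ,
            empiricalEnergyField ((Φ N).flow t z) ψ) ∂(localGibbsLaw σ a₀ u₀ θ₀ N (Φ N))) -
        ∫ p, F (empiricalDensityField
              (lambertFlow (Torus.geometry (Fin 3)) (hsDiameter σ N) p.2 p.1 t) ψ,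
            empiricalMomentumField
              (lambertFlow (Torus.geometry (Fin 3)) (hsDiameter σ N) p.2 p.1 t) ψ,
            empiricalEnergyField
              (lambertFlow (Torus.geometry (Fin 3)) (hsDiameter σ N) p.2 p.1 t) ψ)
          ∂((localGibbsLaw σ a₀ u₀ θ₀ N (Φ N)).prod (lambertNoise (Fin 3))))
      atTop (𝓝 0))
    {χ : T3 → ℝ} (hχ : Continuous χ) :
    Tendsto (fun N : ℕ =>
      (∫ z, F (empiricalDensityField ((Φ N).flow t z) χ,
          empiricalMomentumField ((Φ N).flow t z) χ,
          empiricalEnergyField ((Φ N).flow t z) χ) ∂(localGibbsLaw σ a₀ u₀ θ₀ N (Φ N))) -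
      ∫ p, F (empiricalDensityField
            (lambertFlow (Torus.geometry (Fin 3)) (hsDiameter σ N) p.2 p.1 t) χ,
          empiricalMomentumField
            (lambertFlow (Torus.geometry (Fin 3)) (hsDiameter σ N) p.2 p.1 t) χ,
          empiricalEnergyField
            (lambertFlow (Torus.geometry (Fin 3)) (hsDiameter σ N) p.2 p.1 t) χ)
        ∂((localGibbsLaw σ a₀ u₀ θ₀ N (Φ N)).prod (lambertNoise (Fin 3))))
    atTop (𝓝 0) := by
  -- the laws are probability measures
  have hPN : ∀ N, IsProbabilityMeasure (localGibbsLaw σ a₀ u₀ θ₀ N (Φ N)) := fun N =>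
    isProbabilityMeasure_localGibbsLaw ha hθ hu ha0 hθ0 (by linarith) N (Φ N)
  -- uniform bound on the kinetic energy per particle
  obtain ⟨C, hC0, hC⟩ :=
    exists_lintegral_sum_norm_sq_localGibbsLaw_le ha hθ hu ha0 hθ0 (σ := σ) (by linarith)
  have heN : ∀ N, Integrable (fun z => empiricalEnergyField z (fun _ => (1 : ℝ)))
      (localGibbsLaw σ a₀ u₀ θ₀ N (Φ N)) ∧
      ∫ z, empiricalEnergyField z (fun _ => (1 : ℝ)) ∂(localGibbsLaw σ a₀ u₀ θ₀ N (Φ N)) ≤ C / 2 :=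
    fun N => integrable_energy_of_lintegral_le _ hC0 (hC N (Φ N))
  -- conservation along `Φ` on the (conull) good set
  have hgood : ∀ N, ∀ᵐ z ∂(localGibbsLaw σ a₀ u₀ θ₀ N (Φ N)), z ∈ (Φ N).good := fun N =>
    localGibbsLaw_compl_good σ a₀ θ₀ u₀ N (Φ N)
  have heflow : ∀ N, (fun z => empiricalEnergyField ((Φ N).flow t z) (fun _ => (1 : ℝ)))
      =ᵐ[localGibbsLaw σ a₀ u₀ θ₀ N (Φ N)] fun z => empiricalEnergyField z (fun _ => (1 : ℝ)) :=
    fun N => by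
    filter_upwards [hgood N] with z hz
    exact empiricalEnergyField_one_flow (Φ N) hz t
  -- non-increase along `Λ`
  have heΛ : ∀ (N : ℕ) (p : Config (N + 1) (Fin 3) T3 × (ℕ → EuclideanSpace ℝ (Fin 3))),
      empiricalEnergyField (lambertFlow (Torus.geometry (Fin 3)) (hsDiameter σ N) p.2 p.1 t)
        (fun _ => (1 : ℝ)) ≤ empiricalEnergyField p.1 (fun _ => (1 : ℝ)) := fun N p => by
    rw [empiricalEnergyField_one_eq, empiricalEnergyField_one_eq]
    exact mul_le_mul_of_nonneg_left (configEnergy_lambertFlow_le _ _ _) (by positivity)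
  have hΛm : ∀ N, Measurable fun p : Config (N + 1) (Fin 3) T3 × (ℕ → EuclideanSpace ℝ (Fin 3)) =>
      lambertFlow (Torus.geometry (Fin 3)) (hsDiameter σ N) p.2 p.1 t := fun N =>
    measurable_lambertFlow_hsDiameter hσ.le hσhalf N t
  -- the `η`-argument
  rw [Metric.tendsto_atTop]
  intro η hη
  set δ' : ℝ := η / (4 * (2 + C)) with hδ'
  have hδ'pos : 0 < δ' := by positivity
  have hδ'η : 2 * (δ' * (1 + C / 2)) ≤ η / 2 := by
    have h4 : 2 * (δ' * (1 + C / 2)) = η / 4 := by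
      rw [hδ']
      field_simp
    rw [h4]
    linarith
  obtain ⟨ψ, hψ, hclose⟩ := exists_isSmooth_near hχ hδ'pos
  have hψc : Continuous ψ := hψ.continuous
  have hlim := hsmooth ψ hψ
  rw [Metric.tendsto_atTop] at hlim
  obtain ⟨N₀, hN₀⟩ := hlim (η / 2) (by positivity)
  refine ⟨N₀, fun N hN => ?_⟩
  have h3 := hN₀ N hN
  rw [Real.dist_0_eq_abs] at h3 ⊢
  haveI := hPN N
  -- the deterministic side
  have h1 := abs_integral_sub_le_of_lipschitz (localGibbsLaw σ a₀ u₀ θ₀ N (Φ N)) hF hF1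
    ((Φ N).measurable_flow t) hχ hψc hδ'pos.le hclose ((heN N).1.congr (heflow N).symm)
    ((integral_congr_ae (heflow N)).trans_le (heN N).2)
  -- the Lambertian side
  have hint : Integrable (fun p : Config (N + 1) (Fin 3) T3 × (ℕ → EuclideanSpace ℝ (Fin 3)) =>
      empiricalEnergyField (lambertFlow (Torus.geometry (Fin 3)) (hsDiameter σ N) p.2 p.1 t)
        (fun _ => (1 : ℝ))) ((localGibbsLaw σ a₀ u₀ θ₀ N (Φ N)).prod (lambertNoise (Fin 3))) :=
    ((heN N).1.comp_fst (lambertNoise (Fin 3))).mono'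
      ((measurable_empiricalEnergyField continuous_const).comp (hΛm N)).aestronglyMeasurable
      (ae_of_all _ fun p => by
        rw [Real.norm_of_nonneg (empiricalEnergyField_one_nonneg _)]
        exact heΛ N p)
  have hB : ∫ p, empiricalEnergyField (lambertFlow (Torus.geometry (Fin 3)) (hsDiameter σ N) p.2 p.1 t)
      (fun _ => (1 : ℝ)) ∂((localGibbsLaw σ a₀ u₀ θ₀ N (Φ N)).prod (lambertNoise (Fin 3))) ≤ C / 2 :=
    calc ∫ p, empiricalEnergyField (lambertFlow (Torus.geometry (Fin 3)) (hsDiameter σ N) p.2 p.1 t)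
          (fun _ => (1 : ℝ)) ∂((localGibbsLaw σ a₀ u₀ θ₀ N (Φ N)).prod (lambertNoise (Fin 3)))
        ≤ ∫ p, empiricalEnergyField p.1 (fun _ => (1 : ℝ))
            ∂((localGibbsLaw σ a₀ u₀ θ₀ N (Φ N)).prod (lambertNoise (Fin 3))) :=
          integral_mono hint ((heN N).1.comp_fst _) fun p => heΛ N p
      _ = ∫ z, empiricalEnergyField z (fun _ => (1 : ℝ)) ∂(localGibbsLaw σ a₀ u₀ θ₀ N (Φ N)) := by
          have h := integral_fun_fst (μ := localGibbsLaw σ a₀ u₀ θ₀ N (Φ N))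
            (ν := lambertNoise (Fin 3))
            (fun z : Config (N + 1) (Fin 3) T3 => empiricalEnergyField z (fun _ => (1 : ℝ)))
          rw [probReal_univ, one_smul] at h
          exact h
      _ ≤ C / 2 := (heN N).2
  have h2 := abs_integral_sub_le_of_lipschitz
    ((localGibbsLaw σ a₀ u₀ θ₀ N (Φ N)).prod (lambertNoise (Fin 3))) hF hF1 (hΛm N) hχ hψc
    hδ'pos.le hclose hint hB
  exact abs_sub_lt_of_near h1 h2 h3 hδ'η

end SwapGapSmoothTest

open SwapGapSmoothTest in
/-- **T1 · SMOOTH TEST FUNCTIONS SUFFICE** (`stub_swapGap_of_smoothTest`, registered stub of line `Sketch`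
for stmt-AtomisticToContinuum-11850): `SwapGap` follows from its restriction to test functions `χ : 𝕋³ → ℝ`
with smooth periodic lift (`Torus.IsSmooth χ`). Proof: given a continuous `χ`, a `1`-Lipschitz `F` bounded
by `1` and `η > 0`, pick a smooth `ψ` with `‖χ − ψ‖_∞ ≤ δ'` (`exists_isSmooth_near`); the field triple is
`δ'(1 + e_1)`-close in the sup metric of `ℝ × V3 × ℝ` (`empiricalFields_sub_le`), the kinetic energy per
particle `e_1` is conserved along `Φ` on the `P_N`-conull good set (`empiricalEnergyField_one_flow`,
`localGibbsLaw_compl_good`), does not increase along `Λ` (`configEnergy_lambertFlow_le`) and has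
`E_{P_N} e_1 ≤ C/2` uniformly in `N` and the flow (`exists_lintegral_sum_norm_sq_localGibbsLaw_le`, `σ ≤ 1/2`);
so both integrals move by at most `δ'(1 + C/2)` when `χ` is replaced by `ψ`, uniformly in `N`, and the
hypothesis at `ψ` concludes (`SwapGapSmoothTest.tendsto_of_smoothTest`; `σ₀ := min (1/2) σ₁`; the crux's
inline `let` block is the Literature Lambertian API definitionally). [folklore] -/
theorem stub_swapGap_of_smoothTest
    (h : ∀ (a₀ θ₀ : T3 → ℝ) (u₀ : T3 → V3), Continuous a₀ → Continuous θ₀ → Continuous u₀ →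
      (∀ x, 0 < a₀ x) → (∀ x, 0 < θ₀ x) →
      ∃ σ₀ : ℝ, 0 < σ₀ ∧ ∀ σ : ℝ, 0 < σ → σ < σ₀ →
        ∀ (T : ℝ) (ρ θ : ℝ → T3 → ℝ) (u : ℝ → T3 → V3), IsHardSphereEulerSolution σ T ρ u θ →
          ∀ Φ : (N : ℕ) → HardSphereFlow (Torus.geometry (Fin 3)) (hsDiameter σ N) (N + 1),
            TendstoHydroFieldsAt (fun N => localGibbsLaw σ a₀ u₀ θ₀ N (Φ N)) Φ ρ u θ 0 →
              ∀ t ∈ Set.Ico 0 T, ∀ χ : T3 → ℝ, Literature.Analysis.FunctionSpaces.Torus.IsSmooth χ →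
                ∀ F : ℝ × V3 × ℝ → ℝ, LipschitzWith 1 F → (∀ y, |F y| ≤ 1) →
                  Tendsto (fun N : ℕ =>
                    (∫ z, F (empiricalDensityField ((Φ N).flow t z) χ,
                        empiricalMomentumField ((Φ N).flow t z) χ,
                        empiricalEnergyField ((Φ N).flow t z) χ) ∂(localGibbsLaw σ a₀ u₀ θ₀ N (Φ N))) -
                    ∫ p, F (empiricalDensityField
                          (lambertFlow (Torus.geometry (Fin 3)) (hsDiameter σ N) p.2 p.1 t) χ,
                        empiricalMomentumField
                          (lambertFlow (Torus.geometry (Fin 3)) (hsDiameter σ N) p.2 p.1 t) χ,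
                        empiricalEnergyField
                          (lambertFlow (Torus.geometry (Fin 3)) (hsDiameter σ N) p.2 p.1 t) χ)
                      ∂((localGibbsLaw σ a₀ u₀ θ₀ N (Φ N)).prod (lambertNoise (Fin 3))))
                  atTop (𝓝 0)) :
    SwapGap := by
  delta Summit.AtomisticToContinuum.HydrodynamicLimit.Theses.LambertianContactSwap.SwapGap
  intro Cfg G ε τ S ldir lpair lstep lstate linst lflow noise fld a₀ θ₀ u₀ ha hθ hu ha0 hθ0
  obtain ⟨σ₁, hσ₁, h'⟩ := h a₀ θ₀ u₀ ha hθ hu ha0 hθ0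
  refine ⟨min 2⁻¹ σ₁, lt_min (by norm_num) hσ₁, ?_⟩
  intro σ hσ hσlt T ρ θ u hE Φ P h0 t ht χ hχ F hF hF1
  have hσhalf : σ < 2⁻¹ := hσlt.trans_le (min_le_left _ _)
  have hσ₁' : σ < σ₁ := hσlt.trans_le (min_le_right _ _)
  exact tendsto_of_smoothTest ha hθ hu ha0 hθ0 hσ hσhalf Φ t hF hF1
    (fun ψ hψ => h' σ hσ hσ₁' T ρ θ u hE Φ h0 t ht ψ hψ F hF hF1) hχ

end Summit.AtomisticToContinuum.HydrodynamicLimit.Theorems
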